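import Mathlib.Analysis.SpecialFunctions.SmoothTransition
import Literature.MathematicalPhysics.StatisticalMechanics.Theil2006EnergyBounds
import HarnessLib

/-!
# Theil 2006, §1: the hypothesis class (1)–(5) of Theorems 1.1, 1.2 and Corollary 1.3 is
NON-EMPTY for every small `α` — an explicit admissible potential

Topic `Literature/MathematicalPhysics/StatisticalMechanics`; companion of `Theil2006.lean`
(F. Theil, *A proof of crystallization in two dimensions*, Comm. Math. Phys. **262** (2006)
209–236, accepted preprint of 26 Aug 2005, §1, Theorem 1.1 with (1)–(5), p. 2).

The three main results of the paper (tree: the named facts `Theil2006_groundStateEnergy`,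
`Theil2006_periodicGroundStates_upToRotation`, `Theil2006_dirichletGroundStates`) quantify over
"each `α ∈ (0, α₀)` and every normalized potential `V` which has the properties
`V ∈ C²(1 − α, ∞)` and (2) `V(r) ≥ 1/α` for `r ∈ [0, 1 − α]`, (3) `V''(r) ≥ 1` for
`r ∈ (1 − α, 1 + α)`, (4) `V(r) ≥ −α` for `r ∈ [1 + α, 4/3]`, (5) `|V''(r)| ≤ α r⁻⁷` for
`r ∈ (4/3, ∞)`" (`Theil2006.IsAdmissible α V`, with the normalization (1)
`min_{r} ∑_{ξ ∈ A₂∖{0}} V(r|ξ|) = ∑_{ξ ∈ A₂∖{0}} V(|ξ|) = −6` and `V → 0`, `Theil2006.IsNormalized`).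
The paper does not exhibit a member of this class (p. 3 only explains how to rescale a general
potential so that (1) holds). Since a sister result in the tree turned out to have an EMPTY
hypothesis class (`FlatleyTheil2015_thm11_printed`, `not_isLocalizedPair_of_differentiableOn`),
we record here that Theil's class is non-empty for every `0 < α ≤ 1/5`, so that the three named
facts are not vacuous:

* `Theil2006.examplePotential α` — the potential `V_α(r) = max(1/α, 2000)` for `r ≤ 1 − α` and
  `V_α(r) = ((r − 1)²/α² − 1)·(1 − χ_α(r))` for `r > 1 − α`, where
  `χ_α(r) = smoothTransition((r − 1 − α)/(¼ − α))` is Mathlib's `C^∞` transition (`= 0` for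
  `r ≤ 1 + α`, `= 1` for `r ≥ 5/4`): a parabolic well of depth `−1` at `r = 1` and curvature
  `2/α²`, vanishing identically beyond `5/4`, with a high constant core;
* `Theil2006.isAdmissible_examplePotential` — **`IsAdmissible α (examplePotential α)` for
  `0 < α ≤ 1/5`**; `Theil2006.exists_isAdmissible` — the class is non-empty.

Proof notes. (2)–(5) and `V ∈ C²(1−α, ∞)` are immediate from the construction (the second
derivative is `2/α²` on `(1 − α, 1 + α)` and `0` beyond `5/4`). Normalization (1): for every
`r > 0` only finitely many `ξ ∈ A₂ ∖ {0}` have `r|ξ| < 5/4`, so the lattice sums are finite sums;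
at `r = 1` the six nearest neighbours contribute `6 · V_α(1) = −6` and every other `ξ`
(`|ξ| ≥ √3 > 5/4`) contributes `0`; for `r > 1 − α` only the six nearest neighbours can fall into
the well (`r√3 ≥ (1 − α)√3 ≥ 1 + α`), each contributing `≥ −1`; for `r ≤ 1 − α` the six nearest
neighbours sit in the core and contribute `6 · max(1/α, 2000)`, more generally every label in the
box `|m|, |n| ≤ ⌊(1 − α)/(2r)⌋` does, while the at most `(2⌈5/(2r)⌉ + 1)²` labels with
`r|ξ| < 5/4` contribute `≥ −1` each — the core wins (`2000` is a convenient, not an optimal,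
constant). Everything here is proved; no named fact is introduced (D-0026).
[cite: Theil2006, §1 Theorem 1.1 (1)–(5) (preprint p. 2); our example]
-/

noncomputable section

open scoped BigOperators Topology
open Filter Set

namespace Literature.MathematicalPhysics.StatisticalMechanics

namespace Theil2006

/-! ### The example potential -/

/-- The smooth cut-off `χ_α(r) = smoothTransition((r − 1 − α)/(¼ − α))`: `0` for `r ≤ 1 + α`,
`1` for `r ≥ 5/4` (`α < 1/4`). [cite: Theil2006, §1 Theorem 1.1 (4)–(5) (preprint p. 2); our example] -/
def exampleCutoff (α r : ℝ) : ℝ :=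
  Real.smoothTransition ((r - (1 + α)) / (1 / 4 - α))

/-- The smooth branch `W_α(r) = ((r − 1)²/α² − 1)(1 − χ_α(r))` of the example potential: a
parabolic well of depth `−1` at `1` and curvature `2/α²`, cut off to `0` beyond `5/4`.
[cite: Theil2006, §1 Theorem 1.1 (3)–(5) (preprint p. 2); our example] -/
def exampleWell (α r : ℝ) : ℝ :=
  ((r - 1) ^ 2 / α ^ 2 - 1) * (1 - exampleCutoff α r)

/-- The core height `B_α = max(1/α, 2000)` of the example potential.
[cite: Theil2006, §1 Theorem 1.1 (2) (preprint p. 2); our example] -/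
def exampleCore (α : ℝ) : ℝ :=
  max (1 / α) 2000

/-- **The example potential** `V_α`: the constant core `B_α` on `[0, 1 − α]` (and on all
`r ≤ 1 − α`), the cut-off parabolic well `W_α` on `(1 − α, ∞)`.
[cite: Theil2006, §1 Theorem 1.1 (1)–(5) (preprint p. 2); our example] -/
def examplePotential (α r : ℝ) : ℝ :=
  if r ≤ 1 - α then exampleCore α else exampleWell α r

section Pointwise

variable {α r : ℝ}

/-- `χ_α = 0` up to `1 + α`. [cite: Theil2006, §1 (preprint p. 2); our example] -/
theorem exampleCutoff_of_le (hα : α < 1 / 4) (h : r ≤ 1 + α) : exampleCutoff α r = 0 := by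
  unfold exampleCutoff
  apply Real.smoothTransition.zero_of_nonpos
  exact div_nonpos_of_nonpos_of_nonneg (by linarith) (by linarith)

/-- `χ_α = 1` from `5/4` on. [cite: Theil2006, §1 (preprint p. 2); our example] -/
theorem exampleCutoff_of_ge (hα : α < 1 / 4) (h : 5 / 4 ≤ r) : exampleCutoff α r = 1 := by
  unfold exampleCutoff
  apply Real.smoothTransition.one_of_one_le
  rw [le_div_iff₀ (by linarith)]
  linarith

/-- `0 ≤ χ_α ≤ 1`. [cite: Theil2006, §1 (preprint p. 2); our example] -/
theorem exampleCutoff_mem_Icc (α r : ℝ) : exampleCutoff α r ∈ Icc (0 : ℝ) 1 :=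
  ⟨Real.smoothTransition.nonneg _, Real.smoothTransition.le_one _⟩

/-- On `(−∞, 1 + α]` the smooth branch is the bare parabola `(r − 1)²/α² − 1`.
[cite: Theil2006, §1 Theorem 1.1 (3) (preprint p. 2); our example] -/
theorem exampleWell_of_le (hα : α < 1 / 4) (h : r ≤ 1 + α) :
    exampleWell α r = (r - 1) ^ 2 / α ^ 2 - 1 := by
  rw [exampleWell, exampleCutoff_of_le hα h, sub_zero, mul_one]

/-- Beyond `5/4` the smooth branch vanishes. [cite: Theil2006, §1 Theorem 1.1 (5) (preprint p. 2); our example] -/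
theorem exampleWell_of_ge (hα : α < 1 / 4) (h : 5 / 4 ≤ r) : exampleWell α r = 0 := by
  rw [exampleWell, exampleCutoff_of_ge hα h, sub_self, mul_zero]

/-- From `1 + α` on the smooth branch is `≥ 0`. [cite: Theil2006, §1 Theorem 1.1 (4) (preprint p. 2); our example] -/
theorem exampleWell_nonneg (hα : 0 < α) (h : 1 + α ≤ r) : 0 ≤ exampleWell α r := by
  unfold exampleWell
  have h1 : α ^ 2 ≤ (r - 1) ^ 2 := by nlinarith
  have h2 : 0 ≤ (r - 1) ^ 2 / α ^ 2 - 1 := by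
    rw [sub_nonneg, le_div_iff₀ (by positivity)]
    linarith
  exact mul_nonneg h2 (by linarith [(exampleCutoff_mem_Icc α r).2])

/-- The smooth branch is `≥ −1` everywhere. [cite: Theil2006, §1 (preprint p. 2); our example] -/
theorem neg_one_le_exampleWell (hα : 0 < α) (r : ℝ) : -1 ≤ exampleWell α r := by
  unfold exampleWell
  obtain ⟨h0, h1⟩ := exampleCutoff_mem_Icc α r
  have hP : -1 ≤ (r - 1) ^ 2 / α ^ 2 - 1 := by
    have : 0 ≤ (r - 1) ^ 2 / α ^ 2 := by positivity
    linarith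
  nlinarith [mul_nonneg (sub_nonneg.2 h1) (show (0 : ℝ) ≤ (r - 1) ^ 2 / α ^ 2 by positivity)]

/-- The smooth branch is `C^∞` (`α ≠ 1/4` is not even needed for this). [cite: Theil2006, §1 Theorem 1.1 («V ∈ C²(1−α,∞)», preprint p. 2); our example] -/
theorem contDiff_exampleWell (α : ℝ) : ContDiff ℝ 2 (exampleWell α) := by
  have h1 : ContDiff ℝ 2 fun r : ℝ => (r - 1) ^ 2 / α ^ 2 - 1 :=
    (((contDiff_id.sub contDiff_const).pow 2).div_const _).sub contDiff_const
  have h2 : ContDiff ℝ 2 fun r : ℝ => 1 - exampleCutoff α r :=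
    contDiff_const.sub ((Real.smoothTransition.contDiff (n := 2)).comp
      ((contDiff_id.sub contDiff_const).div_const _))
  exact h1.mul h2

/-- Off the core the example potential is its smooth branch. [cite: Theil2006, §1 (preprint p. 2); our example] -/
theorem examplePotential_of_lt (h : 1 - α < r) : examplePotential α r = exampleWell α r := by
  rw [examplePotential, if_neg (not_le.2 h)]

/-- On the core the example potential is the constant `B_α`. [cite: Theil2006, §1 Theorem 1.1 (2) (preprint p. 2); our example] -/
theorem examplePotential_of_le (h : r ≤ 1 - α) : examplePotential α r = exampleCore α := by
  rw [examplePotential, if_pos h]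

/-- `B_α ≥ 1/α` and `B_α ≥ 2000`. [cite: Theil2006, §1 Theorem 1.1 (2) (preprint p. 2); our example] -/
theorem le_exampleCore (α : ℝ) : 1 / α ≤ exampleCore α ∧ 2000 ≤ exampleCore α :=
  ⟨le_max_left _ _, le_max_right _ _⟩

/-- The example potential is `≥ −1` everywhere (`0 < α`). [cite: Theil2006, §1 (preprint p. 2); our example] -/
theorem neg_one_le_examplePotential (hα : 0 < α) (r : ℝ) : -1 ≤ examplePotential α r := by
  by_cases h : r ≤ 1 - α
  · rw [examplePotential_of_le h]
    linarith [(le_exampleCore α).2]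
  · rw [examplePotential_of_lt (not_le.1 h)]
    exact neg_one_le_exampleWell hα r

/-- The example potential is `≥ 0` off the well `(1 − α, 1 + α)` (`0 < α`). [cite: Theil2006, §1 Theorem 1.1 (2), (4) (preprint p. 2); our example] -/
theorem examplePotential_nonneg_of_le (hα : 0 < α) (h : 1 + α ≤ r) : 0 ≤ examplePotential α r := by
  rw [examplePotential_of_lt (by linarith)]
  exact exampleWell_nonneg hα h

/-- Beyond `5/4` the example potential vanishes. [cite: Theil2006, §1 (preprint p. 2); our example] -/
theorem examplePotential_of_ge (hα : 0 < α) (hα4 : α < 1 / 4) (h : 5 / 4 ≤ r) :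
    examplePotential α r = 0 := by
  rw [examplePotential_of_lt (by linarith), exampleWell_of_ge hα4 h]

/-- `V_α(1) = −1`. [cite: Theil2006, §1 (1) (preprint p. 2); our example] -/
theorem examplePotential_one (hα : 0 < α) (hα4 : α < 1 / 4) : examplePotential α 1 = -1 := by
  rw [examplePotential_of_lt (by linarith), exampleWell_of_le hα4 (by linarith)]
  simp

end Pointwise

/-! ### Derivatives: `V'' = 2/α²` in the well, `V'' = 0` beyond `5/4` -/

section Derivatives

variable {α r : ℝ}

/-- In the well the example potential is locally the parabola. [cite: Theil2006, §1 Theorem 1.1 (3) (preprint p. 2); our example] -/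
theorem examplePotential_eventuallyEq_parabola (hα4 : α < 1 / 4)
    (hr : r ∈ Ioo (1 - α) (1 + α)) :
    examplePotential α =ᶠ[𝓝 r] fun s => (s - 1) ^ 2 / α ^ 2 - 1 := by
  filter_upwards [Ioo_mem_nhds hr.1 hr.2] with s hs
  rw [examplePotential_of_lt hs.1, exampleWell_of_le hα4 hs.2.le]

/-- The second derivative of the parabola `(s − 1)²/α² − 1` is `2/α²`. [folklore] -/
private theorem deriv_deriv_parabola (α r : ℝ) :
    deriv (deriv fun s : ℝ => (s - 1) ^ 2 / α ^ 2 - 1) r = 2 / α ^ 2 := by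
  have hd : deriv (fun s : ℝ => (s - 1) ^ 2 / α ^ 2 - 1) = fun s => 2 / α ^ 2 * (s - 1) := by
    funext s
    have h : HasDerivAt (fun s : ℝ => (s - 1) ^ 2 / α ^ 2 - 1)
        (((2 : ℕ) : ℝ) * (s - 1) ^ (2 - 1) * 1 / α ^ 2) s :=
      ((((hasDerivAt_id s).sub_const 1).pow 2).div_const (α ^ 2)).sub_const 1
    rw [h.deriv]
    simp
    ring
  rw [hd]
  have h2 : HasDerivAt (fun s : ℝ => 2 / α ^ 2 * (s - 1)) (2 / α ^ 2 * 1) r :=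
    ((hasDerivAt_id r).sub_const 1).const_mul _
  rw [h2.deriv, mul_one]

/-- **(3) for the example**: `V_α'' = 2/α²` on `(1 − α, 1 + α)`.
[cite: Theil2006, §1 Theorem 1.1 (3) (preprint p. 2); our example] -/
theorem deriv2_examplePotential_of_mem_Ioo (hα4 : α < 1 / 4)
    (hr : r ∈ Ioo (1 - α) (1 + α)) :
    deriv^[2] (examplePotential α) r = 2 / α ^ 2 := by
  show deriv (deriv (examplePotential α)) r = 2 / α ^ 2
  rw [(examplePotential_eventuallyEq_parabola hα4 hr).deriv.deriv_eq]
  exact deriv_deriv_parabola α r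

/-- Beyond `5/4` the example potential is locally `0`. [cite: Theil2006, §1 Theorem 1.1 (5) (preprint p. 2); our example] -/
theorem examplePotential_eventuallyEq_zero (hα : 0 < α) (hα4 : α < 1 / 4) (hr : 5 / 4 < r) :
    examplePotential α =ᶠ[𝓝 r] fun _ => (0 : ℝ) := by
  filter_upwards [Ioi_mem_nhds hr] with s hs
  exact examplePotential_of_ge hα hα4 (le_of_lt hs)

/-- **(5) for the example**: `V_α'' = 0` beyond `5/4`.
[cite: Theil2006, §1 Theorem 1.1 (5) (preprint p. 2); our example] -/
theorem deriv2_examplePotential_of_gt (hα : 0 < α) (hα4 : α < 1 / 4) (hr : 5 / 4 < r) :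
    deriv^[2] (examplePotential α) r = 0 := by
  show deriv (deriv (examplePotential α)) r = 0
  rw [(examplePotential_eventuallyEq_zero hα hα4 hr).deriv.deriv_eq]
  simp

end Derivatives

/-! ### Labels of bounded norm lie in a box; a box of labels has bounded norm -/

section Box

/-- The box of labels `[−N, N]²`. [folklore] -/
def labelSquare (N : ℕ) : Finset (ℤ × ℤ) :=
  Finset.Icc (-(N : ℤ)) N ×ˢ Finset.Icc (-(N : ℤ)) N

/-- The box has `(2N + 1)²` labels. [folklore] -/
private theorem card_labelSquare (N : ℕ) : (labelSquare N).card = (2 * N + 1) ^ 2 := by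
  rw [labelSquare, Finset.card_product, Int.card_Icc, sq]
  have : ((N : ℤ) + 1 - -(N : ℤ)).toNat = 2 * N + 1 := by omega
  rw [this]

/-- Membership in the box by coordinates. [folklore] -/
private theorem mem_labelSquare {N : ℕ} {k : ℤ × ℤ} :
    k ∈ labelSquare N ↔ |k.1| ≤ N ∧ |k.2| ≤ N := by
  simp only [labelSquare, Finset.mem_product, Finset.mem_Icc, abs_le]

/-- A label of norm `≤ ρ` has both coordinates of size `≤ 2ρ`
(`|ξ|² = (m + n/2)² + ¾ n²`). [folklore] -/
private theorem abs_le_of_norm_triPoint_le {k : ℤ × ℤ} {ρ : ℝ} (h : ‖triPoint k‖ ≤ ρ) :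
    |(k.1 : ℝ)| ≤ 2 * ρ ∧ |(k.2 : ℝ)| ≤ 2 * ρ := by
  have hρ : 0 ≤ ρ := (norm_nonneg _).trans h
  have hsq : (k.1 : ℝ) ^ 2 + k.1 * k.2 + k.2 ^ 2 ≤ ρ ^ 2 := by
    have e := norm_triPoint_sq k
    push_cast at e
    nlinarith [norm_nonneg (triPoint k)]
  constructor
  · refine abs_le.2 (abs_le_of_sq_le_sq' ?_ (by positivity))
    nlinarith [sq_nonneg ((k.1 : ℝ) + 2 * k.2)]
  · refine abs_le.2 (abs_le_of_sq_le_sq' ?_ (by positivity))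
    nlinarith [sq_nonneg ((k.2 : ℝ) + 2 * k.1)]

/-- A label of norm `≤ ρ` lies in the box `[−N, N]²` once `2ρ ≤ N`. [folklore] -/
private theorem mem_labelSquare_of_norm_le {k : ℤ × ℤ} {ρ : ℝ} {N : ℕ} (h : ‖triPoint k‖ ≤ ρ)
    (hN : 2 * ρ ≤ N) : k ∈ labelSquare N := by
  obtain ⟨h1, h2⟩ := abs_le_of_norm_triPoint_le h
  rw [mem_labelSquare]
  have h1' : |(k.1 : ℝ)| ≤ (N : ℝ) := h1.trans hN
  have h2' : |(k.2 : ℝ)| ≤ (N : ℝ) := h2.trans hN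
  rw [← Int.cast_abs] at h1' h2'
  exact ⟨by exact_mod_cast h1', by exact_mod_cast h2'⟩

/-- A label in the box `[−M, M]²` has norm `≤ 2M` (`m² + mn + n² ≤ 3M²`). [folklore] -/
private theorem norm_triPoint_le_of_mem_labelSquare {k : ℤ × ℤ} {M : ℕ} (hk : k ∈ labelSquare M) :
    ‖triPoint k‖ ≤ 2 * M := by
  rw [mem_labelSquare] at hk
  obtain ⟨h1, h2⟩ := hk
  have h1' : |(k.1 : ℝ)| ≤ M := by exact_mod_cast h1
  have h2' : |(k.2 : ℝ)| ≤ M := by exact_mod_cast h2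
  have hsq : ‖triPoint k‖ ^ 2 ≤ (2 * (M : ℝ)) ^ 2 := by
    rw [norm_triPoint_sq]
    push_cast
    have ha := abs_le.1 h1'
    have hb := abs_le.1 h2'
    have hmn : (k.1 : ℝ) * k.2 ≤ (M : ℝ) * M := by
      have h := mul_le_mul h1' h2' (abs_nonneg _) (Nat.cast_nonneg M)
      rw [← abs_mul] at h
      exact (le_abs_self _).trans h
    nlinarith
  exact (abs_le_of_sq_le_sq' hsq (by positivity)).2

/-- The unit shell lies in every box `[−N, N]²`, `N ≥ 1`. [folklore] -/
private theorem unitShell_subset_labelSquare {N : ℕ} (hN : 1 ≤ N) : unitShell ⊆ labelSquare N := by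
  intro k hk
  rw [mem_labelSquare]
  simp only [unitShell, Finset.mem_insert, Finset.mem_singleton] at hk
  have hN' : (1 : ℤ) ≤ N := by exact_mod_cast hN
  rcases hk with rfl | rfl | rfl | rfl | rfl | rfl <;> simp <;> omega

end Box

/-! ### The lattice sums of the example: finite sums -/

section LatticeSums

variable {α : ℝ}

/-- For `r > 0` the dilated lattice potential of the example vanishes off the box
`[−N, N]²`, `N = ⌈5/(2r)⌉` (there `r|ξ| ≥ 5/4`). [cite: Theil2006, §1 (1) (preprint p. 2); our example] -/
theorem latticePotential_example_eq_zero (hα : 0 < α) (hα4 : α < 1 / 4) {r : ℝ} (hr : 0 < r)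
    {k : ℤ × ℤ} (hk : k ∉ labelSquare ⌈5 / (2 * r)⌉₊) :
    latticePotential (fun s => examplePotential α (r * s)) k = 0 := by
  by_cases hk0 : k = 0
  · subst hk0; simp
  rw [latticePotential_of_ne _ hk0]
  apply examplePotential_of_ge hα hα4
  by_contra hlt
  rw [not_le] at hlt
  apply hk
  apply mem_labelSquare_of_norm_le (ρ := 5 / (4 * r))
  · rw [le_div_iff₀ (by positivity)]
    nlinarith
  · have : 2 * (5 / (4 * r)) = 5 / (2 * r) := by field_simp; ring
    rw [this]
    exact Nat.le_ceil _

/-- **The lattice sums of the example are finite sums**: for `r > 0`,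
`∑_{ξ ≠ 0} V_α(r|ξ|) = ∑_{k ∈ [−N,N]²} latticePotential`, as a `HasSum` statement.
[cite: Theil2006, §1 (1) (preprint p. 2); our example] -/
theorem hasSum_example (hα : 0 < α) (hα4 : α < 1 / 4) {r : ℝ} (hr : 0 < r) :
    HasSum (fun k : {k : ℤ × ℤ // k ≠ 0} => examplePotential α (r * ‖triPoint k.1‖))
      (∑ k ∈ labelSquare ⌈5 / (2 * r)⌉₊, latticePotential (fun s => examplePotential α (r * s)) k) :=
  hasSum_latticePotential_iff.1
    (hasSum_sum_of_ne_finset_zero fun _ hk => latticePotential_example_eq_zero hα hα4 hr hk)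

/-- The lattice sum of the example as a finite sum. [cite: Theil2006, §1 (1) (preprint p. 2); our example] -/
theorem latticeSum_example (hα : 0 < α) (hα4 : α < 1 / 4) {r : ℝ} (hr : 0 < r) :
    latticeSum (examplePotential α) r =
      ∑ k ∈ labelSquare ⌈5 / (2 * r)⌉₊, latticePotential (fun s => examplePotential α (r * s)) k :=
  (hasSum_example hα hα4 hr).tsum_eq

/-- **(1) for the example, the value at `r = 1`**: `∑_{ξ ≠ 0} V_α(|ξ|) = −6` (the six nearest
neighbours give `−1` each, all other `ξ` have `|ξ| ≥ √3 > 5/4`).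
[cite: Theil2006, §1 (1) (preprint p. 2); our example] -/
theorem latticeSum_example_one (hα : 0 < α) (hα4 : α < 1 / 4) :
    latticeSum (examplePotential α) 1 = -6 := by
  have h3 : (5 : ℝ) / 4 < √3 := (Real.lt_sqrt (by norm_num)).2 (by norm_num)
  have hzero : ∀ k ∉ unitShell, latticePotential (fun s => examplePotential α (1 * s)) k = 0 := by
    intro k hk
    by_cases hk0 : k = 0
    · subst hk0; simp
    rw [latticePotential_of_ne _ hk0, one_mul]
    exact examplePotential_of_ge hα hα4 (h3.le.trans (sqrt_three_le_norm_triPoint hk0 hk))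
  have h := hasSum_latticePotential_iff.1 (hasSum_sum_of_ne_finset_zero hzero)
  rw [sum_unitShell_latticePotential, examplePotential_one hα hα4] at h
  have h' := h.tsum_eq
  simp only [one_mul] at h'
  rw [latticeSum]
  simp only [one_mul]
  rw [h']
  norm_num

/-- **(1) for the example, the minimum**: `∑_{ξ ≠ 0} V_α(r|ξ|) ≥ −6` for every `r > 0`
(`0 < α ≤ 1/5`). For `r > 1 − α` only the six nearest neighbours can be in the well; for
`r ≤ 1 − α` the labels of the box `|m|,|n| ≤ ⌊(1−α)/(2r)⌋` and the six nearest neighbours are in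
the core (`≥ 2000` each) and beat the at most `(2⌈5/(2r)⌉+1)²` terms `≥ −1`.
[cite: Theil2006, §1 (1) (preprint p. 2); our example] -/
theorem le_latticeSum_example (hα : 0 < α) (hα5 : α ≤ 1 / 5) {r : ℝ} (hr : 0 < r) :
    -6 ≤ latticeSum (examplePotential α) r := by
  classical
  have hα4 : α < 1 / 4 := by linarith
  set V := examplePotential α with hV
  set lp : ℤ × ℤ → ℝ := latticePotential (fun s => V (r * s)) with hlp
  set N : ℕ := ⌈5 / (2 * r)⌉₊ with hNdef
  rw [latticeSum_example hα hα4 hr]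
  -- every term is `≥ -1`
  have hge : ∀ k, -1 ≤ lp k := by
    intro k
    by_cases hk0 : k = 0
    · subst hk0; simp [hlp]
    rw [hlp, latticePotential_of_ne _ hk0]
    exact neg_one_le_examplePotential hα _
  by_cases hcase : 1 - α < r
  · -- only the unit shell can be in the well
    have h3 : (1 + α) / (1 - α) ≤ √3 := by
      rw [div_le_iff₀ (by linarith)]
      have hs : (17 : ℝ) / 10 < √3 := (Real.lt_sqrt (by norm_num)).2 (by norm_num)
      nlinarith
    have hout : ∀ k ∉ unitShell, 0 ≤ lp k := by
      intro k hk
      by_cases hk0 : k = 0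
      · subst hk0; simp [hlp]
      rw [hlp, latticePotential_of_ne _ hk0]
      apply examplePotential_nonneg_of_le hα
      have hn := sqrt_three_le_norm_triPoint hk0 hk
      have h1 : (1 + α) / (1 - α) ≤ ‖triPoint k‖ := h3.trans hn
      rw [div_le_iff₀ (by linarith)] at h1
      nlinarith [norm_nonneg (triPoint k)]
    -- split the box into the unit shell part and the rest
    have hsplit := Finset.sum_filter_add_sum_filter_not (labelSquare N) (fun k => k ∈ unitShell) lp
    rw [← hsplit]
    have hA : -6 ≤ ∑ k ∈ (labelSquare N).filter (fun k => k ∈ unitShell), lp k := by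
      have hcard : ((labelSquare N).filter (fun k => k ∈ unitShell)).card ≤ 6 := by
        rw [← card_unitShell]
        exact Finset.card_le_card fun k hk => (Finset.mem_filter.1 hk).2
      have h := Finset.card_nsmul_le_sum ((labelSquare N).filter (fun k => k ∈ unitShell)) lp (-1)
        fun k _ => hge k
      rw [nsmul_eq_mul] at h
      have hc : (((labelSquare N).filter (fun k => k ∈ unitShell)).card : ℝ) ≤ 6 := by
        exact_mod_cast hcard
      linarith
    have hB : 0 ≤ ∑ k ∈ (labelSquare N).filter (fun k => ¬ k ∈ unitShell), lp k :=
      Finset.sum_nonneg fun k hk => hout k (Finset.mem_filter.1 hk).2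
    linarith
  · -- `r ≤ 1 - α`: the core wins
    rw [not_lt] at hcase
    have hr1 : r < 1 := by linarith
    set B := exampleCore α with hBdef
    have hB2000 : (2000 : ℝ) ≤ B := (le_exampleCore α).2
    set M : ℕ := ⌊(1 - α) / (2 * r)⌋₊ with hMdef
    -- the core labels: the box of size `M` without the origin, and the unit shell
    set C : Finset (ℤ × ℤ) := (labelSquare M).erase 0 ∪ unitShell with hCdef
    have hN1 : 1 ≤ N := by
      have h : (1 : ℝ) ≤ 5 / (2 * r) := by
        rw [le_div_iff₀ (by positivity)]; linarith
      have := Nat.one_le_ceil_iff.2 (lt_of_lt_of_le (by norm_num) h)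
      simpa [hNdef] using this
    have hMN : M ≤ N := by
      have h1 : (M : ℝ) ≤ (1 - α) / (2 * r) := Nat.floor_le (div_nonneg (by linarith) (by positivity))
      have h2 : (1 - α) / (2 * r) ≤ 5 / (2 * r) := by
        apply div_le_div_of_nonneg_right _ (by positivity); linarith
      have h3 : (5 / (2 * r) : ℝ) ≤ N := Nat.le_ceil _
      exact_mod_cast h1.trans (h2.trans h3)
    have hCsub : C ⊆ labelSquare N := by
      intro k hk
      rw [hCdef, Finset.mem_union] at hk
      rcases hk with hk | hk
      · have hk' := (Finset.mem_erase.1 hk).2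
        rw [mem_labelSquare] at hk' ⊢
        have : (M : ℤ) ≤ N := by exact_mod_cast hMN
        exact ⟨hk'.1.trans this, hk'.2.trans this⟩
      · exact unitShell_subset_labelSquare hN1 hk
    -- on `C` the potential is the core value
    have hcoreval : ∀ k ∈ C, lp k = B := by
      intro k hk
      rw [hCdef, Finset.mem_union] at hk
      have hk0 : k ≠ 0 := by
        rcases hk with hk | hk
        · exact (Finset.mem_erase.1 hk).1
        · rintro rfl
          have := norm_triPoint_of_mem_unitShell hk
          rw [map_zero, norm_zero] at this
          exact zero_ne_one this
      rw [hlp, latticePotential_of_ne _ hk0]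
      apply examplePotential_of_le
      rcases hk with hk | hk
      · have hn := norm_triPoint_le_of_mem_labelSquare (Finset.mem_erase.1 hk).2
        have hM : (M : ℝ) ≤ (1 - α) / (2 * r) := Nat.floor_le (div_nonneg (by linarith) (by positivity))
        rw [le_div_iff₀ (by positivity)] at hM
        nlinarith [norm_nonneg (triPoint k)]
      · rw [norm_triPoint_of_mem_unitShell hk, mul_one]
        exact hcase
    -- lower bound: `B #C - #(box \ C)`
    have hsum : B * C.card - ((labelSquare N).card : ℝ) ≤ ∑ k ∈ labelSquare N, lp k := by
      rw [← Finset.sum_sdiff hCsub]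
      have h1 : ∑ k ∈ C, lp k = B * C.card := by
        rw [Finset.sum_congr rfl hcoreval, Finset.sum_const, nsmul_eq_mul, mul_comm]
      have h2 : -(((labelSquare N \ C).card : ℝ)) ≤ ∑ k ∈ labelSquare N \ C, lp k := by
        have h := Finset.card_nsmul_le_sum (labelSquare N \ C) lp (-1) fun k _ => hge k
        rw [nsmul_eq_mul] at h
        linarith
      have h3 : ((labelSquare N \ C).card : ℝ) ≤ (labelSquare N).card := by
        exact_mod_cast Finset.card_le_card Finset.sdiff_subset
      linarith
    refine le_trans ?_ hsum
    -- the counts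
    have hFcard : ((labelSquare N).card : ℝ) = (2 * N + 1) ^ 2 := by
      rw [card_labelSquare]; push_cast; ring
    have hC6 : (6 : ℝ) ≤ C.card := by
      have : unitShell.card ≤ C.card := Finset.card_le_card Finset.subset_union_right
      rw [card_unitShell] at this
      exact_mod_cast this
    have hCM : (2 * (M : ℝ) + 1) ^ 2 - 1 ≤ C.card := by
      have h1 : ((labelSquare M).erase 0).card ≤ C.card := Finset.card_le_card Finset.subset_union_left
      have h0 : (0 : ℤ × ℤ) ∈ labelSquare M := by rw [mem_labelSquare]; simp
      rw [Finset.card_erase_of_mem h0, card_labelSquare] at h1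
      have h2 : (((2 * M + 1) ^ 2 - 1 : ℕ) : ℝ) ≤ C.card := by exact_mod_cast h1
      have h3 : (1 : ℕ) ≤ (2 * M + 1) ^ 2 := Nat.one_le_pow _ _ (by omega)
      rw [Nat.cast_sub h3] at h2
      push_cast at h2
      linarith
    set u : ℝ := r⁻¹ with hu
    have hu1 : 1 ≤ u := by rw [hu]; exact (one_le_inv₀ hr).2 hr1.le
    have hur : u * r = 1 := by rw [hu]; exact inv_mul_cancel₀ hr.ne'
    have hN' : (N : ℝ) ≤ 5 / 2 * u + 1 := by
      have h : (N : ℝ) < 5 / (2 * r) + 1 := Nat.ceil_lt_add_one (by positivity)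
      have e : 5 / (2 * r) = 5 / 2 * u := by rw [hu]; field_simp
      linarith
    have hM' : (1 - α) / 2 * u - 1 ≤ M := by
      have h : (1 - α) / (2 * r) < M + 1 := Nat.lt_floor_add_one _
      have e : (1 - α) / (2 * r) = (1 - α) / 2 * u := by rw [hu]; field_simp
      linarith
    have hM0 : (0 : ℝ) ≤ M := Nat.cast_nonneg _
    rw [hFcard]
    by_cases hu10 : u ≤ 10
    · -- few terms: the six core neighbours suffice
      have h1 : (2 * (N : ℝ) + 1) ^ 2 ≤ 53 ^ 2 := by
        have : 2 * (N : ℝ) + 1 ≤ 53 := by linarith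
        exact pow_le_pow_left₀ (by positivity) this 2
      nlinarith
    · -- many terms: the core box grows like `u²`
      rw [not_le] at hu10
      have h1 : 2 * (N : ℝ) + 1 ≤ 8 * u := by linarith
      have h2 : (2 * (N : ℝ) + 1) ^ 2 ≤ (8 * u) ^ 2 := pow_le_pow_left₀ (by positivity) h1 2
      have h3 : 7 / 10 * u ≤ 2 * (M : ℝ) + 1 := by nlinarith
      have h4 : (7 / 10 * u) ^ 2 ≤ (2 * (M : ℝ) + 1) ^ 2 := pow_le_pow_left₀ (by positivity) h3 2
      nlinarith

end LatticeSums

/-! ### The example is admissible -/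

section Admissible

variable {α : ℝ}

/-- **Normalization (1) for the example.** [cite: Theil2006, §1 (1) (preprint p. 2); our example] -/
theorem isNormalized_examplePotential (hα : 0 < α) (hα5 : α ≤ 1 / 5) :
    IsNormalized (examplePotential α) := by
  have hα4 : α < 1 / 4 := by linarith
  refine ⟨?_, fun r hr => (hasSum_example hα hα4 hr).summable,
    latticeSum_example_one hα hα4, fun r hr => le_latticeSum_example hα hα5 hr⟩
  -- `V → 0`: eventually `0`
  refine tendsto_const_nhds.congr' ?_
  filter_upwards [eventually_ge_atTop (5 / 4 : ℝ)] with r hr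
  exact (examplePotential_of_ge hα hα4 hr).symm

/-- **The example potential satisfies (1)–(5)**: `IsAdmissible α (examplePotential α)` for every
`0 < α ≤ 1/5`. [cite: Theil2006, §1 Theorem 1.1 (1)–(5) (preprint p. 2); our example] -/
theorem isAdmissible_examplePotential (hα : 0 < α) (hα5 : α ≤ 1 / 5) :
    IsAdmissible α (examplePotential α) := by
  have hα4 : α < 1 / 4 := by linarith
  refine { isNormalized_examplePotential hα hα5 with
    contDiffOn := ?_, core := ?_, convex := ?_, well := ?_, decay := ?_ }
  · exact (contDiff_exampleWell α).contDiffOn.congr fun r hr => examplePotential_of_lt hr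
  · intro r hr
    rw [examplePotential_of_le hr.2]
    exact (le_exampleCore α).1
  · intro r hr
    rw [deriv2_examplePotential_of_mem_Ioo hα4 hr, le_div_iff₀ (by positivity)]
    nlinarith
  · intro r hr
    linarith [examplePotential_nonneg_of_le hα hr.1]
  · intro r hr
    rw [deriv2_examplePotential_of_gt hα hα4 (by linarith), abs_zero]
    positivity

/-- **The hypothesis class of Theil 2006, Theorems 1.1/1.2 and Corollary 1.3, is non-empty**:
for every `0 < α ≤ 1/5` there is a potential `V` satisfying (1)–(5).
[cite: Theil2006, §1 Theorem 1.1 (1)–(5) (preprint p. 2); our example] -/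
theorem exists_isAdmissible (hα : 0 < α) (hα5 : α ≤ 1 / 5) : ∃ V : ℝ → ℝ, IsAdmissible α V :=
  ⟨examplePotential α, isAdmissible_examplePotential hα hα5⟩

end Admissible

end Theil2006

end Literature.MathematicalPhysics.StatisticalMechanics

end
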